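import Literature.MathematicalPhysics.QuantumFieldTheory.Balaban1983to89.B11Eq135WeitzenbockCarrier
import Literature.MathematicalPhysics.QuantumFieldTheory.Balaban1983to89.B9Eq342GreenPrimeSupBound

/-!
# `Balaban1983to89.B9Eq326LocalPartKatoForm` — T. Bałaban, *Propagators for lattice gauge theories in a background field*, Commun. Math. Phys. **99**
# (1985) 389–434 [Balaban1985BackgroundPropagators] (3.10) p. 392, (3.23) p. 394, (3.26) p. 395, with [Balaban1985Variational] (134)–(135) p. 298:
# **THE LOCAL PART `A₀ = Δ(U) + D_UD*_U + aQ*Q` OF `Δ_a` (3.26) IN KATO FORM** — on the chain's `L²` bond carrier, `D*D + DD* = Δ_U − η⁻²𝒦`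
# (`B11Eq135WeitzenbockCarrier.eq135_carrier` read through the identifications), hence `A₀ = [Δ_U (Kato form) + aQ*Q] + [Δ′ − η⁻²𝒦]`, and at every bond
# `Σ_{j ∈ Fin d ⊕ Fin d} η⁻²·(u(b) − T_{bj}u(nbr(b,j))) = (A₀u)(b) − ((Δ′ + aQ*Q − η⁻²𝒦)u)(b)` — the `hu` letter of `B9Eq342SupNormBootstrapLinf` for `A₀`

statement-level skeleton of published theorems with citation tags; proofs where landed; nothing here is a claim about the Yang–Mills mass gap

CITATION HEADER (lean-in-tree rule).  Audit cell `pub-balaban`, sub-cell `t4`, BINDER row NE9; filed by the NE9 BINDER-row OWNER lineage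
`b2b-balaban-t4-ne9-p1` (gen 92) as the second half of stone (K0) of its plan v11 (`t4/b2b-balaban-t4-ne9-p1/g91/PLAN-V11-STOREY-G1.md` §1: «`A₀(U) = L_K(U) +
K(U) + aQ*Q`, `L_K` Kato form (weights `η⁻²`), `K = Δ′ + W` local»).  Imports: `B11Eq135WeitzenbockCarrier` (this lineage, gen 92: (135) on the carrier for
arbitrary transporter data) and `B9Eq342GreenPrimeSupBound` (this lineage, gen 89: `adTransportW_inv_adTransportW`, and through it `B9Eq310HessianOperator`:
`principalOpK`, `curvOp`, `hessOp`, `adTransportW`; `B11Eq103H1Complex`: `BondL2K`, `covDerivL2K`, `covDivL2K`).  Sources READ first-hand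
(`paper:balaban1985-cmp99-background-propagators`, journal page = PDF page + 388): p. 392 (3.10) *«⟨A, ΔA⟩ = ⟨A, D*DA⟩ + ⟨A, Δ′A⟩»*, p. 394 (3.23) *«Δ^η_U =
D^{η*}_UD^η_U»*, p. 395 (3.26) *«Δ_a(U) = Δ(U) + D_UR(U)D*_U + Q*(U)aQ(U)»*; [Balaban1985Variational] p. 298 (134)–(135) (quoted in `B11Eq135WeitzenbockCarrier`).

WHAT IS DEFINED AND PROVED (sorry-free; [folklore] readings + one unfolding; no inequality of the paper).
* §1 **`bondLapK 𝕜 c₀ c R S`**, **`weitzOpK 𝕜 c₀ R S`** — `B11Eq135WeitzenbockCarrier.covBondLap` ∕ `weitzOp` READ ON `BondL2K` (like `covDerivL2K`); `equiv_bondLapK`,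
  `equiv_weitzOpK` (`rfl`).
* §2 **`principal_add_DDstar_eq`** — for EVERY `c`, `R`, `S`: `(D*_SD_R)^{L²} + covDerivL2K c R ∘ covDivL2K c S = bondLapK c R S − (c·c) • weitzOpK R S`;
  **`principalOpK_add_DDstar_eq`** — the chain's instance: `principalOpK φ η U + D_U ∘ D*_U = bondLapK η⁻¹ (Ad U) (Ad U⁻¹) − η⁻² • weitzOpK (Ad U) (Ad U⁻¹)`.
* §3 **`localPart_eq_kato_add`** — `A₀ := hessOp φ η U τ + D_U∘D*_U + Q†∘(a•Q)` (the `hA₀` letter of `B9Eq326WoodburySchur.G1ofU_eq_woodbury`) EQUALS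
  `(bondLapK + Q†∘(a•Q)) + (curvOp φ τ η U − η⁻² • weitzOpK)` — Kato part plus block-local penalty plus the ZEROTH-ORDER remainder `K = Δ′ − η⁻²𝒦`.
* §4 **`kato_form_localPart`** — THE `hu` LETTER: for every `u` and every bond `b = (x, μ)`, with `nbr`, `T` the `2d` parallel neighbours `(x ∓ e_ν, μ)` transported
  by `R(U(x−e_ν,ν)⁻¹)` ∕ `R(U(x,ν))` (the SAME `Fin d ⊕ Fin d` graph letters as `B9Eq342GreenPrimeSupBoundDecay.kato_form_GpOfU`, per component `μ`):
  `Σ_j η⁻²·(u(b) − T_{bj}u(nbr b j)) = (A₀u)(b) − ((curvOp + Q†(a•Q) − η⁻²•weitzOpK)u)(b)`.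
HONEST SCOPE.  Readings and one algebraic rearrangement; the SIZE of `K = Δ′ − η⁻²𝒦` on print's class (3.35) (`O(α₀)`, [B11] (136) ∕ [B9] (3.69)) is NOT asserted
here (the `𝒦` half is `B11Eq135WeitzenbockCarrier.norm_weitzOp_apply_le` with a displayed holonomy letter; the `Δ′` half lives on the abstract model as
`B9Eq310Hermitian.norm_deltaPrimeOp_le`); nothing of [B9] Thm 3.1∕3.3∕3.11 asserted; «NE9 ⇐ the named binders»; NE9 NOT PRINTED ∕ NOT PROVED; row WALLED ON A
MODEL (O-NE9-1; #5 UNRULED); spine PROVED 0∕9; rung (B)+1 on a finite T⁴ — NOT infinite volume, NOT mass gap, NOT BetaPertH, NOT Clay.  HONEST DEPENDENCY: continuum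
YM on T⁴ ⇐ BetaPertH ∧ nine spine estimates (0/9 proved); BetaPertH ⇐ (D1) ∧ (D4) ∧ CAP+tail.  NEW file; nothing modified.  Net new unproved facts: 0.
-/

noncomputable section

open scoped BigOperators

namespace Literature.MathematicalPhysics.QuantumFieldTheory.Balaban1983to89.B9Eq326LocalPartKatoForm

open B9SectCLatticeCarrier (Bond shift unshift)
open B4Sect5Torus (TSite)
open B9Eq311L2Pairing (WL2)
open B9Eq33CovDerivVector (covDeriv covDiv)
open B9Eq34CovCurlVector (covLapPrincipal)
open B11Eq103H1Complex (BondL2K covDerivL2K covDivL2K equiv_covDerivL2K equiv_covDivL2K)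
open B9Eq310HessianOperator (adTransportW principalOpK curvOp hessOp equiv_principalOpK)
open B11Eq135WeitzenbockCarrier (covBondLap weitzOp covBondLap_apply_eq_sum eq135_carrier weitzOp_apply)
open B9Eq342GreenPrimeSupBound (adTransportW_inv_adTransportW)

/-! ## §1 `Δ_U` componentwise and `𝒦` read on the `L²` bond carrier -/

section Readings

variable (𝕜 : Type*) [RCLike 𝕜] {d : ℕ} {Pd : Fin d → ℕ} {W : Type*} [NormedAddCommGroup W] [InnerProductSpace 𝕜 W] {c₀ : ℝ} [Fact (0 < c₀)]

/-- **`Δ_U` componentwise on `BondL2K`** — `B11Eq135WeitzenbockCarrier.covBondLap` read through the identifications (print's `Δ_{U₀}A₀,μ` of (135); (3.23)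
per component). [cite: Balaban1985BackgroundPropagators, (3.23) p.394; Balaban1985Variational, (135) p.298] -/
def bondLapK (c₀ : ℝ) (c : 𝕜) (R S : Bond d Pd → W →ₗ[𝕜] W) [Fact (0 < c₀)] : BondL2K 𝕜 d Pd c₀ W →ₗ[𝕜] BondL2K 𝕜 d Pd c₀ W :=
  (WL2.linearEquiv 𝕜 𝕜 (fun _ : Bond d Pd => c₀)).symm.toLinearMap ∘ₗ covBondLap c R S ∘ₗ
    (WL2.linearEquiv 𝕜 𝕜 (fun _ : Bond d Pd => c₀)).toLinearMap

/-- **The curvature operator `𝒦` of (135) on `BondL2K`** — `B11Eq135WeitzenbockCarrier.weitzOp` read through the identifications.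
[cite: Balaban1985Variational, (135) p.298] -/
def weitzOpK (c₀ : ℝ) (R S : Bond d Pd → W →ₗ[𝕜] W) [Fact (0 < c₀)] : BondL2K 𝕜 d Pd c₀ W →ₗ[𝕜] BondL2K 𝕜 d Pd c₀ W :=
  (WL2.linearEquiv 𝕜 𝕜 (fun _ : Bond d Pd => c₀)).symm.toLinearMap ∘ₗ weitzOp R S ∘ₗ
    (WL2.linearEquiv 𝕜 𝕜 (fun _ : Bond d Pd => c₀)).toLinearMap

variable {𝕜}

/-- Unfolding: `bondLapK` is `covBondLap` read through the identifications. [cite: Balaban1985BackgroundPropagators, (3.23) p.394] -/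
theorem equiv_bondLapK (c : 𝕜) (R S : Bond d Pd → W →ₗ[𝕜] W) (A : BondL2K 𝕜 d Pd c₀ W) :
    WL2.equiv 𝕜 _ W (bondLapK 𝕜 c₀ c R S A) = covBondLap c R S (WL2.equiv 𝕜 _ W A) := rfl

/-- Unfolding: `weitzOpK` is `weitzOp` read through the identifications. [cite: Balaban1985Variational, (135) p.298] -/
theorem equiv_weitzOpK (R S : Bond d Pd → W →ₗ[𝕜] W) (A : BondL2K 𝕜 d Pd c₀ W) :
    WL2.equiv 𝕜 _ W (weitzOpK 𝕜 c₀ R S A) = weitzOp R S (WL2.equiv 𝕜 _ W A) := rfl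

/-! ## §2 (135) on `BondL2K`: `D*D + DD* = Δ_U − c²𝒦` -/

/-- **(135) ON THE `L²` BOND CARRIER, every `c`, `R`, `S`**: the principal part `D*_SD_R` of (3.10) read on `BondL2K` plus `covDerivL2K c R ∘ covDivL2K c S`
equals `bondLapK c R S − (c·c) • weitzOpK R S`. [cite: Balaban1985Variational, (135) p.298; Balaban1985BackgroundPropagators, (3.10) p.392] -/
theorem principal_add_DDstar_eq (c : 𝕜) (R S : Bond d Pd → W →ₗ[𝕜] W) :
    (WL2.linearEquiv 𝕜 𝕜 (fun _ : Bond d Pd => c₀)).symm.toLinearMap ∘ₗ covLapPrincipal c R S ∘ₗ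
        (WL2.linearEquiv 𝕜 𝕜 (fun _ : Bond d Pd => c₀)).toLinearMap +
      covDerivL2K 𝕜 c₀ c R ∘ₗ covDivL2K 𝕜 c₀ c S =
    bondLapK 𝕜 c₀ c R S - (c * c) • weitzOpK 𝕜 c₀ R S := by
  apply LinearMap.ext
  intro A
  apply (WL2.equiv 𝕜 (fun _ : Bond d Pd => c₀) W).injective
  funext b
  have h := eq135_carrier c R S (WL2.equiv 𝕜 _ W A) b
  simp only [LinearMap.add_apply, LinearMap.sub_apply, LinearMap.smul_apply, LinearMap.comp_apply, WL2.equiv_add, WL2.equiv_sub,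
    WL2.equiv_smul, Pi.add_apply, Pi.sub_apply, Pi.smul_apply, equiv_covDerivL2K, equiv_covDivL2K, equiv_bondLapK, equiv_weitzOpK]
  exact h

end Readings

/-! ## §2 (continued) and §3: the chain's instance — the local part `A₀` of (3.26) -/

section Instance

open scoped InnerProductSpace

variable {d : ℕ} {Pd : Fin d → ℕ} {𝔸 : Type*} [Ring 𝔸] [StarRing 𝔸] [Algebra ℂ 𝔸] [StarModule ℂ 𝔸]
  {W : Type*} [NormedAddCommGroup W] [InnerProductSpace ℂ W] [FiniteDimensional ℂ W] (φ : W ≃ₗ[ℂ] 𝔸) {c₀ : ℝ} [Fact (0 < c₀)]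
  (η : ℝ) (U : Bond d Pd → 𝔸ˣ) (τ : 𝔸 →ₗ[ℂ] ℂ) {F : Type*} [NormedAddCommGroup F] [InnerProductSpace ℂ F] [FiniteDimensional ℂ F]
  (Q : BondL2K ℂ d Pd c₀ W →ₗ[ℂ] F) (a : ℝ)

omit [StarRing 𝔸] [StarModule ℂ 𝔸] [FiniteDimensional ℂ W] in
/-- **THE CHAIN's `D*D + DD*`** (transporters `R(U(b))`, `R(U(b)⁻¹)` read on the fibre along `φ`, difference quotient `η⁻¹`):
`principalOpK φ η U + D_U ∘ D*_U = bondLapK η⁻¹ − η⁻²•weitzOpK`. [cite: Balaban1985Variational, (135) p.298; Balaban1985BackgroundPropagators, (3.10) p.392] -/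
theorem principalOpK_add_DDstar_eq :
    principalOpK (c₀ := c₀) φ η U +
        covDerivL2K ℂ c₀ ((η : ℂ))⁻¹ (adTransportW φ U) ∘ₗ covDivL2K ℂ c₀ ((η : ℂ))⁻¹ (adTransportW φ fun b => (U b)⁻¹) =
      bondLapK ℂ c₀ ((η : ℂ))⁻¹ (adTransportW φ U) (adTransportW φ fun b => (U b)⁻¹) -
        (((η : ℂ))⁻¹ * ((η : ℂ))⁻¹) • weitzOpK ℂ c₀ (adTransportW φ U) (adTransportW φ fun b => (U b)⁻¹) :=
  principal_add_DDstar_eq ((η : ℂ))⁻¹ (adTransportW φ U) (adTransportW φ fun b => (U b)⁻¹)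

/-- **THE LOCAL PART OF (3.26) = KATO PART + PENALTY + ZEROTH-ORDER REMAINDER**: with `A₀ = Δ(U) + D_UD*_U + Q†(a•Q)` (`Δ(U) = D*D + Δ′`, `hessOp`) —
the `hA₀` letter of `B9Eq326WoodburySchur.G1ofU_eq_woodbury` —
`A₀ = (bondLapK η⁻¹ + Q†(a•Q)) + (curvOp φ τ η U − η⁻²•weitzOpK)`: the covariant bond Laplacian in Kato form plus the block-local penalty, plus `K = Δ′ − η⁻²𝒦`
(zeroth order, `O(α₀)` on print's class (3.35) — NOT asserted here). [cite: Balaban1985BackgroundPropagators, (3.26) p.395, (3.10) p.392; Balaban1985Variational, (134)–(135) p.298] -/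
theorem localPart_eq_kato_add
    (A₀ : BondL2K ℂ d Pd c₀ W →ₗ[ℂ] BondL2K ℂ d Pd c₀ W)
    (hA₀ : A₀ = hessOp φ η U τ + covDerivL2K ℂ c₀ ((η : ℂ))⁻¹ (adTransportW φ U) ∘ₗ covDivL2K ℂ c₀ ((η : ℂ))⁻¹ (adTransportW φ fun b => (U b)⁻¹) +
      LinearMap.adjoint Q ∘ₗ ((a : ℂ) • Q)) :
    A₀ = (bondLapK ℂ c₀ ((η : ℂ))⁻¹ (adTransportW φ U) (adTransportW φ fun b => (U b)⁻¹) + LinearMap.adjoint Q ∘ₗ ((a : ℂ) • Q)) +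
      (curvOp φ τ η U - (((η : ℂ))⁻¹ * ((η : ℂ))⁻¹) • weitzOpK ℂ c₀ (adTransportW φ U) (adTransportW φ fun b => (U b)⁻¹)) := by
  have h := principalOpK_add_DDstar_eq φ η U (c₀ := c₀)
  rw [eq_sub_iff_add_eq] at h
  rw [hA₀, hessOp, ← h]
  abel

/-! ## §4 The `hu` letter: `A₀u` in Kato form at every bond -/

/-- **`A₀` IN KATO FORM, BONDWISE** (the `hu` letter of `B9Eq342SupNormBootstrapLinf.norm_le_of_kato_bootstrap_linf` ∕ `B9Eq342SupNormBootstrap` for the LOCAL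
part of (3.26)): at the bond `b = (x, μ)`, with the `2d` parallel neighbours `nbr b (inl ν) = (x − e_ν, μ)`, `nbr b (inr ν) = (x + e_ν, μ)` transported by
`T_{b,inl ν} = R(U(x−e_ν,ν)⁻¹)`, `T_{b,inr ν} = R(U(x,ν))` (read on the fibre along `φ`) and the weight `η⁻²`:
`Σ_{j : Fin d ⊕ Fin d} η⁻²·(u(b) − T_{bj}u(nbr b j)) = (A₀u)(b) − ((Δ′ + Q†(a•Q) − η⁻²𝒦)u)(b)`, `A₀ = hessOp + D_U∘D*_U + Q†(a•Q)` — every `u`, no hypothesis on `U`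
beyond `R(U(b)⁻¹)R(U(b)) = 1` (automatic). [cite: Balaban1985BackgroundPropagators, (3.26) p.395, (3.23) p.394, (3.10) p.392; Balaban1985Variational, (135) p.298] -/
theorem kato_form_localPart (u : BondL2K ℂ d Pd c₀ W) (b : Bond d Pd) :
    ∑ j : Fin d ⊕ Fin d, (RCLike.ofReal ((η⁻¹) ^ 2) : ℂ) •
        (WL2.equiv ℂ _ W u b -
          (Sum.elim (fun ν => adTransportW φ (fun b => (U b)⁻¹) (unshift ν b.1, ν)) (fun ν => adTransportW φ U (b.1, ν)) j : W →ₗ[ℂ] W)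
            (WL2.equiv ℂ _ W u (Sum.elim (fun ν => (unshift ν b.1, b.2)) (fun ν => (shift ν b.1, b.2)) j))) =
      WL2.equiv ℂ _ W ((hessOp φ η U τ +
          covDerivL2K ℂ c₀ ((η : ℂ))⁻¹ (adTransportW φ U) ∘ₗ covDivL2K ℂ c₀ ((η : ℂ))⁻¹ (adTransportW φ fun b => (U b)⁻¹) +
            LinearMap.adjoint Q ∘ₗ ((a : ℂ) • Q) : BondL2K ℂ d Pd c₀ W →ₗ[ℂ] BondL2K ℂ d Pd c₀ W) u) b -
        WL2.equiv ℂ _ W ((curvOp φ τ η U + LinearMap.adjoint Q ∘ₗ ((a : ℂ) • Q) -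
          (((η : ℂ))⁻¹ * ((η : ℂ))⁻¹) • weitzOpK ℂ c₀ (adTransportW φ U) (adTransportW φ fun b => (U b)⁻¹) :
            BondL2K ℂ d Pd c₀ W →ₗ[ℂ] BondL2K ℂ d Pd c₀ W) u) b := by
  obtain ⟨x, μ⟩ := b
  -- the right-hand side is `(bondLapK u)(x, μ)`
  have key : (hessOp φ η U τ +
        covDerivL2K ℂ c₀ ((η : ℂ))⁻¹ (adTransportW φ U) ∘ₗ covDivL2K ℂ c₀ ((η : ℂ))⁻¹ (adTransportW φ fun b => (U b)⁻¹) +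
          LinearMap.adjoint Q ∘ₗ ((a : ℂ) • Q) : BondL2K ℂ d Pd c₀ W →ₗ[ℂ] BondL2K ℂ d Pd c₀ W) -
      (curvOp φ τ η U + LinearMap.adjoint Q ∘ₗ ((a : ℂ) • Q) -
        (((η : ℂ))⁻¹ * ((η : ℂ))⁻¹) • weitzOpK ℂ c₀ (adTransportW φ U) (adTransportW φ fun b => (U b)⁻¹)) =
      bondLapK ℂ c₀ ((η : ℂ))⁻¹ (adTransportW φ U) (adTransportW φ fun b => (U b)⁻¹) := by
    rw [localPart_eq_kato_add φ η U τ Q a _ rfl]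
    abel
  rw [← Pi.sub_apply, ← WL2.equiv_sub, ← LinearMap.sub_apply, key, equiv_bondLapK,
    covBondLap_apply_eq_sum _ _ _ (adTransportW_inv_adTransportW φ U) _ x μ, Fintype.sum_sum_type, ← Finset.sum_add_distrib]
  have hcast : (RCLike.ofReal ((η⁻¹) ^ 2) : ℂ) = ((η : ℂ))⁻¹ * ((η : ℂ))⁻¹ := by
    show ((η⁻¹ ^ 2 : ℝ) : ℂ) = _
    push_cast
    ring
  refine Finset.sum_congr rfl fun ν _ => ?_
  rw [← smul_add, hcast]
  rfl

end Instance

end Literature.MathematicalPhysics.QuantumFieldTheory.Balaban1983to89.B9Eq326LocalPartKatoForm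

end
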